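import Summits.AtomisticToContinuum.Crystallization.Theorems.ExcessDecayLiouvilleScaleArithBrackets

/-!
# Route `ExcessDecayLiouville`: scaling form of the named currencies (Θ₁, Θ₂, V², J)

Harmonic-replacement architecture for item `ExcessDecay` (stmt-AtomisticToContinuum-9334), nonlinear half.
Pure real-variable inequalities bounding the named currencies of `ExcessDecayLiouvilleScaleDefs` by monomials in the
scale `ρ`, the mass constant `C`, the matching radius `r`, the crude bound `Du`, the forcing floor `Φ = phiOf Du r δ`
and the global gradient bound `N`, with every numerical constant absorbed into powers of the level constant
`L = lcOf κ ≥ 2.39·10⁸` (`1/κ ≤ L`).  This file: `Θ₁ ≤ L¹⁶(Cρ + ρ²Φ² + Du²/(ρr⁴) + ρ²N/r⁷)`, `Θ₂ ≤ L¹⁷(C/ρ + Φ² + Du²/(ρ²r⁴) + ρ²N/r⁷)`, `V²`, `J`.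
All `[folklore]`; helper lemmas, nothing here closes an item.
-/

noncomputable section

namespace Summit.AtomisticToContinuum.Crystallization.Theorems.ExcessDecayLiouville

/-- Assembly of `Θ₁` from the two brackets. [folklore] -/
theorem theta_one_assemble {L ρ B₁ B₂ S₃ S' S : ℝ} (hL : 239000000 ≤ L) (hρ : 64 ≤ ρ)
    (hB₁ : B₁ ≤ ρ ^ 3 * L ^ 13 * S₃) (hB₂ : ρ ^ 3 * B₂ ≤ L ^ 11 * S') (hS₃ : S₃ ≤ S) (hS' : S' ≤ S) (hS : 0 ≤ S) :
    64 * L ^ 3 / (9 * ρ) ^ 3 * B₁ + 536 * L ^ 3 * (9 * ρ) ^ 3 * B₂ ≤ L ^ 16 * S := by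
  have hρ0 : 0 < ρ := by linarith
  have hL0 : 0 ≤ L := le_trans (by norm_num) hL
  have h1 : 64 * L ^ 3 / (9 * ρ) ^ 3 * B₁ ≤ (64 / 729) * L ^ 16 * S := by
    calc 64 * L ^ 3 / (9 * ρ) ^ 3 * B₁ ≤ 64 * L ^ 3 / (9 * ρ) ^ 3 * (ρ ^ 3 * L ^ 13 * S₃) :=
          mul_le_mul_of_nonneg_left hB₁ (by positivity)
      _ = (64 / 729) * L ^ 16 * S₃ := by field_simp; ring
      _ ≤ (64 / 729) * L ^ 16 * S := mul_le_mul_of_nonneg_left hS₃ (by positivity)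
  have h2 : 536 * L ^ 3 * (9 * ρ) ^ 3 * B₂ ≤ 390744 * L ^ 14 * S := by
    calc 536 * L ^ 3 * (9 * ρ) ^ 3 * B₂ = 390744 * L ^ 3 * (ρ ^ 3 * B₂) := by ring
      _ ≤ 390744 * L ^ 3 * (L ^ 11 * S') := mul_le_mul_of_nonneg_left hB₂ (by positivity)
      _ = 390744 * L ^ 14 * S' := by ring
      _ ≤ 390744 * L ^ 14 * S := mul_le_mul_of_nonneg_left hS' (by positivity)
  have hL2 : (239000000 : ℝ) ^ 2 ≤ L ^ 2 := pow_le_pow_left₀ (by norm_num) hL 2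
  have hcoef : (64 / 729) * L ^ 16 + 390744 * L ^ 14 ≤ L ^ 16 := by
    have h : (390744 : ℝ) ≤ (665 / 729) * L ^ 2 := le_trans (by norm_num) (mul_le_mul_of_nonneg_left hL2 (by norm_num))
    have hL14 : 0 ≤ L ^ 14 := by positivity
    nlinarith only [mul_le_mul_of_nonneg_right h hL14]
  nlinarith only [h1, h2, mul_le_mul_of_nonneg_right hcoef hS]

/-- Assembly of `Θ₂` from the two brackets. [folklore] -/
theorem theta_two_assemble {L ρ B₁ B₂ S₃ S' : ℝ} (hL : 239000000 ≤ L) (hρ : 64 ≤ ρ)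
    (hB₁ : B₁ ≤ ρ ^ 3 * L ^ 13 * S₃) (hB₂ : ρ ^ 3 * B₂ ≤ L ^ 11 * S') (hS₃ : S₃ ≤ ρ ^ 2 * S') (hS : 0 ≤ S') :
    64 * L ^ 4 / (9 * ρ) ^ 5 * B₁ + (64 * L ^ 4 / (9 * ρ) ^ 3 + 3216 * L ^ 4 * (9 * ρ) ^ 3) * B₂ ≤ L ^ 17 * S' := by
  have hρ0 : 0 < ρ := by linarith
  have hρ1 : (1 : ℝ) ≤ ρ := by linarith
  have hL0 : 0 ≤ L := le_trans (by norm_num) hL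
  have h1 : 64 * L ^ 4 / (9 * ρ) ^ 5 * B₁ ≤ (64 / 59049) * L ^ 17 * S' := by
    calc 64 * L ^ 4 / (9 * ρ) ^ 5 * B₁ ≤ 64 * L ^ 4 / (9 * ρ) ^ 5 * (ρ ^ 3 * L ^ 13 * S₃) :=
          mul_le_mul_of_nonneg_left hB₁ (by positivity)
      _ = (64 / 59049) * L ^ 17 * (S₃ / ρ ^ 2) := by field_simp; ring
      _ ≤ (64 / 59049) * L ^ 17 * S' := by
          refine mul_le_mul_of_nonneg_left ?_ (by positivity)
          rw [div_le_iff₀ (by positivity)]; linarith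
  have h2 : (64 * L ^ 4 / (9 * ρ) ^ 3 + 3216 * L ^ 4 * (9 * ρ) ^ 3) * B₂ ≤ 2344465 * L ^ 15 * S' := by
    have e : (64 * L ^ 4 / (9 * ρ) ^ 3 + 3216 * L ^ 4 * (9 * ρ) ^ 3) * B₂ =
        (64 / 729 / ρ ^ 6 + 2344464) * L ^ 4 * (ρ ^ 3 * B₂) := by field_simp; ring
    rw [e]
    have hρ6 : (1 : ℝ) ≤ ρ ^ 6 := one_le_pow₀ hρ1
    have hc : (64 / 729 / ρ ^ 6 + 2344464 : ℝ) ≤ 2344465 := by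
      have : (64 / 729 / ρ ^ 6 : ℝ) ≤ 1 := by rw [div_le_one (by positivity)]; linarith
      linarith
    have hc0 : (0 : ℝ) ≤ 64 / 729 / ρ ^ 6 + 2344464 := by positivity
    calc (64 / 729 / ρ ^ 6 + 2344464) * L ^ 4 * (ρ ^ 3 * B₂) ≤ (64 / 729 / ρ ^ 6 + 2344464) * L ^ 4 * (L ^ 11 * S') :=
          mul_le_mul_of_nonneg_left hB₂ (by positivity)
      _ ≤ 2344465 * L ^ 4 * (L ^ 11 * S') := by
          refine mul_le_mul_of_nonneg_right (mul_le_mul_of_nonneg_right hc (by positivity)) (by positivity)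
      _ = 2344465 * L ^ 15 * S' := by ring
  have hL2 : (239000000 : ℝ) ^ 2 ≤ L ^ 2 := pow_le_pow_left₀ (by norm_num) hL 2
  have hcoef : (64 / 59049) * L ^ 17 + 2344465 * L ^ 15 ≤ L ^ 17 := by
    have h : (2344465 : ℝ) ≤ (58985 / 59049) * L ^ 2 := le_trans (by norm_num) (mul_le_mul_of_nonneg_left hL2 (by norm_num))
    have hL15 : 0 ≤ L ^ 15 := by positivity
    nlinarith only [mul_le_mul_of_nonneg_right h hL15]
  nlinarith only [h1, h2, mul_le_mul_of_nonneg_right hcoef hS]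

/-- **The slope coefficient in monomial form**: `Θ₁ ≤ L¹⁶ (Cρ + ρ²Φ² + Du²/(ρr⁴) + ρ²N/r⁷)`. [folklore] -/
theorem thetaOneOf_le {κ ρ C r δ Du j b Ntot : ℝ} (hκ : 0 < κ) (hκ1 : κ ≤ 1) (hρ : 64 ≤ ρ) (hρr : ρ ≤ r) (hC : 0 ≤ C)
    (hr : 1 ≤ r) (hDu : 0 ≤ Du) (hj : 0 ≤ j) (hb : 0 ≤ b) (hΛ1 : lamOf Du j b ≤ 1) (hN : 0 ≤ Ntot) :
    thetaOneOf κ ρ C r δ Du Du j b Ntot ≤ lcOf κ ^ 16 *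
      (C * ρ + ρ ^ 2 * phiOf Du r δ ^ 2 + Du ^ 2 / (ρ * r ^ 4) + ρ ^ 2 * Ntot / r ^ 7) := by
  have hρ0 : 0 < ρ := by linarith
  have hρ1 : (1 : ℝ) ≤ ρ := by linarith
  have hr0 : 0 < r := by linarith
  obtain ⟨hL, -, -⟩ := lcOf_ge hκ hκ1
  have hΛ0 : 0 ≤ lamOf Du j b := by unfold lamOf; positivity
  have hY0 : 0 < yOf ρ := by have := yOf_ge ρ; linarith
  have hM := mshOf_le (C := C) hκ hκ1 hρ hC
  have hW := wsqOf_le (δ := δ) hκ hκ1 hρ hρr hC hr hDu hj hb hΛ1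
  have hW0 : 0 ≤ wsqOf κ ρ C r δ Du Du j b := by unfold wsqOf; have := ewOf_nonneg κ ρ C r δ Du Du j b; positivity
  have hE := ewOf_le (δ := δ) hκ hκ1 hρ hρr hC hr hDu hj hb hΛ1
  have hE0 := ewOf_nonneg κ ρ C r δ Du Du j b
  have hJv := jvOf_le (C := C) (Dv := Du) (Y := yOf ρ) hC hr0 (by positivity : (0 : ℝ) < 90 * ρ) (yOf_ge ρ)
  have hP := pyOf_le (δ := δ) hκ hκ1 hρ hC hr hDu hj hb hΛ1 hN
  have hB₁ := bracket_one_le hL hρ hr hC hΛ0 hΛ1 hM hW0 hW hJv hY0 (yOf_ge ρ)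
  have hB₂ := bracket_two_le hL hρ hr hC hN hΛ0 hΛ1 hP hE0 hE hY0 (yOf_ge ρ)
  have hm1 : 0 ≤ C * ρ := by positivity
  have hm2 : 0 ≤ ρ ^ 2 * phiOf Du r δ ^ 2 := by positivity
  have hm3 : 0 ≤ Du ^ 2 / (ρ * r ^ 4) := by positivity
  have hm4 : 0 ≤ ρ ^ 2 * Ntot / r ^ 7 := by positivity
  have hS₃ : C * ρ + ρ ^ 2 * phiOf Du r δ ^ 2 + Du ^ 2 / (ρ * r ^ 4) ≤
      C * ρ + ρ ^ 2 * phiOf Du r δ ^ 2 + Du ^ 2 / (ρ * r ^ 4) + ρ ^ 2 * Ntot / r ^ 7 := by linarith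
  have hS' : C / ρ + phiOf Du r δ ^ 2 + Du ^ 2 / (ρ ^ 2 * r ^ 4) + ρ ^ 2 * Ntot / r ^ 7 ≤
      C * ρ + ρ ^ 2 * phiOf Du r δ ^ 2 + Du ^ 2 / (ρ * r ^ 4) + ρ ^ 2 * Ntot / r ^ 7 := by
    have h1 : C / ρ ≤ C * ρ := by
      rw [div_le_iff₀ hρ0]
      have := mul_nonneg (mul_nonneg hC (sub_nonneg.2 hρ1)) (by linarith : 0 ≤ ρ + 1)
      nlinarith only [this, hC]
    have h2 : phiOf Du r δ ^ 2 ≤ ρ ^ 2 * phiOf Du r δ ^ 2 := by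
      have : (1 : ℝ) ≤ ρ ^ 2 := one_le_pow₀ hρ1
      nlinarith only [this, sq_nonneg (phiOf Du r δ)]
    have h3 : Du ^ 2 / (ρ ^ 2 * r ^ 4) ≤ Du ^ 2 / (ρ * r ^ 4) := by
      refine div_le_div_of_nonneg_left (by positivity) (by positivity) ?_
      have : ρ ≤ ρ ^ 2 := by nlinarith only [hρ1]
      nlinarith only [this, pow_pos hr0 4]
    linarith
  unfold thetaOneOf
  exact theta_one_assemble hL hρ hB₁ hB₂ hS₃ hS' (by positivity)

/-- **The Taylor coefficient in monomial form**: `Θ₂ ≤ L¹⁷ (C/ρ + Φ² + Du²/(ρ²r⁴) + ρ²N/r⁷)`. [folklore] -/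
theorem thetaTwoOf_le {κ ρ C r δ Du j b Ntot : ℝ} (hκ : 0 < κ) (hκ1 : κ ≤ 1) (hρ : 64 ≤ ρ) (hρr : ρ ≤ r) (hC : 0 ≤ C)
    (hr : 1 ≤ r) (hDu : 0 ≤ Du) (hj : 0 ≤ j) (hb : 0 ≤ b) (hΛ1 : lamOf Du j b ≤ 1) (hN : 0 ≤ Ntot) :
    thetaTwoOf κ ρ C r δ Du Du j b Ntot ≤ lcOf κ ^ 17 *
      (C / ρ + phiOf Du r δ ^ 2 + Du ^ 2 / (ρ ^ 2 * r ^ 4) + ρ ^ 2 * Ntot / r ^ 7) := by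
  have hρ0 : 0 < ρ := by linarith
  have hρ1 : (1 : ℝ) ≤ ρ := by linarith
  have hr0 : 0 < r := by linarith
  obtain ⟨hL, -, -⟩ := lcOf_ge hκ hκ1
  have hΛ0 : 0 ≤ lamOf Du j b := by unfold lamOf; positivity
  have hY0 : 0 < yOf ρ := by have := yOf_ge ρ; linarith
  have hM := mshOf_le (C := C) hκ hκ1 hρ hC
  have hW := wsqOf_le (δ := δ) hκ hκ1 hρ hρr hC hr hDu hj hb hΛ1
  have hW0 : 0 ≤ wsqOf κ ρ C r δ Du Du j b := by unfold wsqOf; have := ewOf_nonneg κ ρ C r δ Du Du j b; positivity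
  have hE := ewOf_le (δ := δ) hκ hκ1 hρ hρr hC hr hDu hj hb hΛ1
  have hE0 := ewOf_nonneg κ ρ C r δ Du Du j b
  have hJv := jvOf_le (C := C) (Dv := Du) (Y := yOf ρ) hC hr0 (by positivity : (0 : ℝ) < 90 * ρ) (yOf_ge ρ)
  have hP := pyOf_le (δ := δ) hκ hκ1 hρ hC hr hDu hj hb hΛ1 hN
  have hB₁ := bracket_one_le hL hρ hr hC hΛ0 hΛ1 hM hW0 hW hJv hY0 (yOf_ge ρ)
  have hB₂ := bracket_two_le hL hρ hr hC hN hΛ0 hΛ1 hP hE0 hE hY0 (yOf_ge ρ)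
  have hn1 : 0 ≤ C / ρ := by positivity
  have hn2 : 0 ≤ phiOf Du r δ ^ 2 := by positivity
  have hn3 : 0 ≤ Du ^ 2 / (ρ ^ 2 * r ^ 4) := by positivity
  have hn4 : 0 ≤ ρ ^ 2 * Ntot / r ^ 7 := by positivity
  have hS₃ : C * ρ + ρ ^ 2 * phiOf Du r δ ^ 2 + Du ^ 2 / (ρ * r ^ 4) ≤
      ρ ^ 2 * (C / ρ + phiOf Du r δ ^ 2 + Du ^ 2 / (ρ ^ 2 * r ^ 4) + ρ ^ 2 * Ntot / r ^ 7) := by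
    have e : ρ ^ 2 * (C / ρ + phiOf Du r δ ^ 2 + Du ^ 2 / (ρ ^ 2 * r ^ 4) + ρ ^ 2 * Ntot / r ^ 7) =
        C * ρ + ρ ^ 2 * phiOf Du r δ ^ 2 + Du ^ 2 / r ^ 4 + ρ ^ 4 * Ntot / r ^ 7 := by field_simp
    rw [e]
    have h3 : Du ^ 2 / (ρ * r ^ 4) ≤ Du ^ 2 / r ^ 4 := by
      refine div_le_div_of_nonneg_left (by positivity) (by positivity) ?_
      nlinarith only [hρ1, pow_pos hr0 4]
    have h4 : 0 ≤ ρ ^ 4 * Ntot / r ^ 7 := by positivity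
    linarith
  unfold thetaTwoOf
  exact theta_two_assemble hL hρ hB₁ hB₂ hS₃ (by positivity)

/-- `2M_sh + 2W ≤ 6 L¹² ρ⁵ (Cρ + ρ²Φ² + Du²/(ρr⁴))`. [folklore] -/
theorem msh_wsq_le {L ρ r C Du Λ Φ M W : ℝ} (hL : 239000000 ≤ L) (hρ : 64 ≤ ρ) (hr : 1 ≤ r) (hC : 0 ≤ C)
    (hΛ0 : 0 ≤ Λ) (hΛ1 : Λ ≤ 1) (hM : M ≤ L ^ 4 * (C * ρ ^ 6))
    (hW : W ≤ L ^ 12 * (C + Λ ^ 2 * C * ρ ^ 6 + ρ ^ 7 * Φ ^ 2 + ρ ^ 4 * Du ^ 2 / r ^ 4)) :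
    2 * M + 2 * W ≤ 6 * L ^ 12 * ρ ^ 5 * (C * ρ + ρ ^ 2 * Φ ^ 2 + Du ^ 2 / (ρ * r ^ 4)) := by
  have hρ0 : 0 < ρ := by linarith
  have hρ1 : (1 : ℝ) ≤ ρ := by linarith
  have hr0 : 0 < r := by linarith
  have hL0 : 0 ≤ L := le_trans (by norm_num) hL
  have hL1 : 1 ≤ L := le_trans (by norm_num) hL
  set S₃ : ℝ := C * ρ + ρ ^ 2 * Φ ^ 2 + Du ^ 2 / (ρ * r ^ 4) with hS₃
  have hm1 : 0 ≤ C * ρ := by positivity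
  have hm2 : 0 ≤ ρ ^ 2 * Φ ^ 2 := by positivity
  have hm3 : 0 ≤ Du ^ 2 / (ρ * r ^ 4) := by positivity
  have hΛ2 : Λ ^ 2 ≤ 1 := pow_le_one₀ hΛ0 hΛ1
  have hρ6 : (1 : ℝ) ≤ ρ ^ 6 := one_le_pow₀ hρ1
  have hSW : C + Λ ^ 2 * C * ρ ^ 6 + ρ ^ 7 * Φ ^ 2 + ρ ^ 4 * Du ^ 2 / r ^ 4 ≤ 2 * ρ ^ 5 * S₃ := by
    have e : 2 * ρ ^ 5 * S₃ = 2 * (C * ρ ^ 6) + 2 * (ρ ^ 7 * Φ ^ 2) + 2 * (ρ ^ 4 * Du ^ 2 / r ^ 4) := by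
      rw [hS₃]; field_simp
    rw [e]
    have h1 : C ≤ C * ρ ^ 6 := by nlinarith only [hC, hρ6]
    have h2 : Λ ^ 2 * C * ρ ^ 6 ≤ C * ρ ^ 6 := by
      have : 0 ≤ C * ρ ^ 6 := by positivity
      nlinarith only [hΛ2, this]
    have h3 : 0 ≤ ρ ^ 7 * Φ ^ 2 := by positivity
    have h4 : 0 ≤ ρ ^ 4 * Du ^ 2 / r ^ 4 := by positivity
    linarith
  have hL4 : L ^ 4 ≤ L ^ 12 := pow_le_pow_right₀ hL1 (by norm_num)
  have h1 : M ≤ L ^ 12 * ρ ^ 5 * S₃ := by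
    calc M ≤ L ^ 4 * (C * ρ ^ 6) := hM
      _ ≤ L ^ 4 * (ρ ^ 5 * S₃) := by
          refine mul_le_mul_of_nonneg_left ?_ (by positivity)
          rw [hS₃]; nlinarith only [hm2, hm3, pow_nonneg hρ0.le 5]
      _ ≤ L ^ 12 * (ρ ^ 5 * S₃) := mul_le_mul_of_nonneg_right hL4 (by positivity)
      _ = L ^ 12 * ρ ^ 5 * S₃ := by ring
  have h2 : W ≤ 2 * (L ^ 12 * ρ ^ 5 * S₃) := by
    calc W ≤ L ^ 12 * (C + Λ ^ 2 * C * ρ ^ 6 + ρ ^ 7 * Φ ^ 2 + ρ ^ 4 * Du ^ 2 / r ^ 4) := hW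
      _ ≤ L ^ 12 * (2 * ρ ^ 5 * S₃) := mul_le_mul_of_nonneg_left hSW (by positivity)
      _ = 2 * (L ^ 12 * ρ ^ 5 * S₃) := by ring
  linarith

/-- **The squared base-value bound in monomial form**: `V² ≤ L¹⁶ (Cρ³ + ρ⁴Φ² + ρ²Du²/r⁴)`. [folklore] -/
theorem vsqOf_le {κ ρ C r δ Du j b : ℝ} (hκ : 0 < κ) (hκ1 : κ ≤ 1) (hρ : 64 ≤ ρ) (hρr : ρ ≤ r) (hC : 0 ≤ C)
    (hr : 1 ≤ r) (hDu : 0 ≤ Du) (hj : 0 ≤ j) (hb : 0 ≤ b) (hΛ1 : lamOf Du j b ≤ 1) :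
    vsqOf κ ρ C r δ Du Du j b ≤ lcOf κ ^ 16 * (C * ρ ^ 3 + ρ ^ 4 * phiOf Du r δ ^ 2 + ρ ^ 2 * Du ^ 2 / r ^ 4) := by
  have hρ0 : 0 < ρ := by linarith
  have hρ1 : (1 : ℝ) ≤ ρ := by linarith
  have hr0 : 0 < r := by linarith
  obtain ⟨hL, -, -⟩ := lcOf_ge hκ hκ1
  have hL0 : 0 ≤ lcOf κ := le_trans (by norm_num) hL
  have hL1 : 1 ≤ lcOf κ := le_trans (by norm_num) hL
  have hΛ0 : 0 ≤ lamOf Du j b := by unfold lamOf; positivity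
  have hM := mshOf_le (C := C) hκ hκ1 hρ hC
  have hW := wsqOf_le (δ := δ) hκ hκ1 hρ hρr hC hr hDu hj hb hΛ1
  have hW0 : 0 ≤ wsqOf κ ρ C r δ Du Du j b := by unfold wsqOf; have := ewOf_nonneg κ ρ C r δ Du Du j b; positivity
  have hJv := jvOf_le (C := C) (Dv := Du) (Y := 10 * ρ + 10) hC hr0 (by positivity : (0 : ℝ) < 10 * ρ) (by linarith)
  have hMW := msh_wsq_le hL hρ hr hC hΛ0 hΛ1 hM hW
  set L := lcOf κ with hLdef
  set Φ := phiOf Du r δ with hΦ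
  set W := wsqOf κ ρ C r δ Du Du j b with hWdef
  set S₃ : ℝ := C * ρ + ρ ^ 2 * Φ ^ 2 + Du ^ 2 / (ρ * r ^ 4) with hS₃
  set T : ℝ := C * ρ ^ 3 + ρ ^ 4 * Φ ^ 2 + ρ ^ 2 * Du ^ 2 / r ^ 4 with hT
  have ht1 : 0 ≤ C * ρ ^ 3 := by positivity
  have ht2 : 0 ≤ ρ ^ 4 * Φ ^ 2 := by positivity
  have ht3 : 0 ≤ ρ ^ 2 * Du ^ 2 / r ^ 4 := by positivity
  have hT0 : 0 ≤ T := by positivity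
  have hS₃0 : 0 ≤ S₃ := by positivity
  -- ρ² S₃ ≤ T and S₃ ≤ T
  have hS₃T : ρ ^ 2 * S₃ ≤ T := by
    have e : ρ ^ 2 * S₃ = C * ρ ^ 3 + ρ ^ 4 * Φ ^ 2 + ρ * Du ^ 2 / r ^ 4 := by rw [hS₃]; field_simp
    rw [e, hT]
    have : ρ * Du ^ 2 / r ^ 4 ≤ ρ ^ 2 * Du ^ 2 / r ^ 4 := by
      refine div_le_div_of_nonneg_right ?_ (by positivity)
      exact mul_le_mul_of_nonneg_right (by nlinarith only [hρ1]) (sq_nonneg Du)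
    linarith
  have hS₃T' : S₃ ≤ T := by
    have : S₃ ≤ ρ ^ 2 * S₃ := by
      have h := one_le_pow₀ (n := 2) hρ1
      nlinarith only [h, hS₃0]
    exact this.trans hS₃T
  -- (1) the sharp mass and the square sum
  have h1 : 64 * L ^ 3 / ρ ^ 3 * (2 * mshOf C ρ + 2 * W) ≤ 384 * L ^ 15 * T := by
    calc 64 * L ^ 3 / ρ ^ 3 * (2 * mshOf C ρ + 2 * W) ≤ 64 * L ^ 3 / ρ ^ 3 * (6 * L ^ 12 * ρ ^ 5 * S₃) :=
          mul_le_mul_of_nonneg_left hMW (by positivity)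
      _ = 384 * L ^ 15 * (ρ ^ 2 * S₃) := by field_simp; ring
      _ ≤ 384 * L ^ 15 * T := mul_le_mul_of_nonneg_left hS₃T (by positivity)
  -- (2) the far mass at 10ρ + 10
  have h2 : 536 * L ^ 3 * ρ ^ 3 * (2 * jvOf C r Du (10 * ρ + 10)) ≤ 10000000000 * L ^ 3 * T := by
    have hJ' : jvOf C r Du (10 * ρ + 10) ≤ (4096 / 100) * (C * ρ ^ 3) / ρ ^ 5 + (89915392 / 10) * (ρ ^ 2 * Du ^ 2 / r ^ 4) / ρ ^ 3 := by
      have e1 : 4096 * C / (10 * ρ) ^ 2 = (4096 / 100) * (C * ρ ^ 3) / ρ ^ 5 := by field_simp; norm_num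
      have e2 : 89915392 * Du ^ 2 / (r ^ 4 * (10 * ρ)) = (89915392 / 10) * (ρ ^ 2 * Du ^ 2 / r ^ 4) / ρ ^ 3 := by
        field_simp
      rw [← e1, ← e2]; exact hJv
    have e : 536 * L ^ 3 * ρ ^ 3 * (2 * ((4096 / 100) * (C * ρ ^ 3) / ρ ^ 5 + (89915392 / 10) * (ρ ^ 2 * Du ^ 2 / r ^ 4) / ρ ^ 3)) =
        1072 * L ^ 3 * ((4096 / 100) * (C * ρ ^ 3) / ρ ^ 2 + (89915392 / 10) * (ρ ^ 2 * Du ^ 2 / r ^ 4)) := by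
      field_simp; ring
    have hρ2 : (1 : ℝ) ≤ ρ ^ 2 := one_le_pow₀ hρ1
    have hd : (4096 / 100) * (C * ρ ^ 3) / ρ ^ 2 ≤ (4096 / 100) * (C * ρ ^ 3) := div_le_self (by positivity) hρ2
    calc 536 * L ^ 3 * ρ ^ 3 * (2 * jvOf C r Du (10 * ρ + 10))
        ≤ 536 * L ^ 3 * ρ ^ 3 * (2 * ((4096 / 100) * (C * ρ ^ 3) / ρ ^ 5 + (89915392 / 10) * (ρ ^ 2 * Du ^ 2 / r ^ 4) / ρ ^ 3)) := by
          refine mul_le_mul_of_nonneg_left ?_ (by positivity); linarith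
      _ = 1072 * L ^ 3 * ((4096 / 100) * (C * ρ ^ 3) / ρ ^ 2 + (89915392 / 10) * (ρ ^ 2 * Du ^ 2 / r ^ 4)) := e
      _ ≤ 1072 * L ^ 3 * ((4096 / 100) * (C * ρ ^ 3) + (89915392 / 10) * (ρ ^ 2 * Du ^ 2 / r ^ 4)) := by
          refine mul_le_mul_of_nonneg_left ?_ (by positivity); linarith
      _ ≤ 10000000000 * L ^ 3 * T := by
          rw [hT]; nlinarith only [ht1, ht2, ht3, pow_nonneg hL0 3]
  -- (3) the floor-weighted square sum
  have h3 : 536 * L ^ 3 * ρ ^ 3 * (2 * (10 * ρ + 10)⁻¹ ^ 8 * W) ≤ L ^ 15 * T := by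
    have hinv : (10 * ρ + 10)⁻¹ ^ 8 ≤ (10 * ρ)⁻¹ ^ 8 :=
      pow_le_pow_left₀ (by positivity) (inv_anti₀ (by positivity) (by linarith)) 8
    have hW2 : W ≤ 3 * (L ^ 12 * ρ ^ 5 * S₃) := by
      have hM0 : 0 ≤ mshOf C ρ := by unfold mshOf; have := rhoP_pos hρ; positivity
      linarith
    calc 536 * L ^ 3 * ρ ^ 3 * (2 * (10 * ρ + 10)⁻¹ ^ 8 * W) ≤ 536 * L ^ 3 * ρ ^ 3 * (2 * (10 * ρ)⁻¹ ^ 8 * (3 * (L ^ 12 * ρ ^ 5 * S₃))) := by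
          refine mul_le_mul_of_nonneg_left ?_ (by positivity)
          exact mul_le_mul (mul_le_mul_of_nonneg_left hinv (by norm_num)) hW2 hW0 (by positivity)
      _ = (3216 / 10 ^ 8) * L ^ 15 * S₃ := by field_simp; ring
      _ ≤ (3216 / 10 ^ 8) * L ^ 15 * T := mul_le_mul_of_nonneg_left hS₃T' (by positivity)
      _ ≤ L ^ 15 * T := by nlinarith only [hT0, pow_nonneg hL0 15]
  have hL12 : (239000000 : ℝ) ^ 12 ≤ L ^ 12 := pow_le_pow_left₀ (by norm_num) hL 12
  have hcoef : 384 * L ^ 15 + 10000000000 * L ^ 3 + L ^ 15 ≤ L ^ 16 := by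
    have h1 : (385 : ℝ) * L ^ 15 ≤ (1 / 2) * L ^ 16 := by
      rw [show L ^ 16 = L ^ 15 * L by ring]; nlinarith only [hL, pow_nonneg hL0 15]
    have h2 : (10000000000 : ℝ) * L ^ 3 ≤ (1 / 2) * L ^ 16 := by
      have : (10000000000 : ℝ) ≤ (1 / 2) * L ^ 12 :=
        (by norm_num : (10000000000 : ℝ) ≤ (1 / 2) * 239000000 ^ 12).trans (by nlinarith only [hL12])
      have h15 : L ^ 15 ≤ L ^ 16 := pow_le_pow_right₀ hL1 (by norm_num)
      calc (10000000000 : ℝ) * L ^ 3 ≤ (1 / 2) * L ^ 12 * L ^ 3 := mul_le_mul_of_nonneg_right this (by positivity)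
        _ = (1 / 2) * L ^ 15 := by ring
        _ ≤ (1 / 2) * L ^ 16 := by linarith
    nlinarith only [h1, h2, pow_nonneg hL0 16]
  unfold vsqOf
  nlinarith only [h1, h2, h3, mul_le_mul_of_nonneg_right hcoef hT0, hT0]

/-- `J_h = 2 J_v(ρ) + 2 ρ⁻⁸ W`. [folklore] -/
theorem jhOf_eq (κ ρ C r δ Du Dv j b : ℝ) :
    jhOf κ ρ C r δ Du Dv j b = 2 * jvOf C r Dv ρ + 2 * ρ⁻¹ ^ 8 * wsqOf κ ρ C r δ Du Dv j b := by
  unfold jhOf jvOf; rfl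

/-- **The far-mass bound of `h` in monomial form**: `J ≤ L¹³ (C/ρ² + Φ²/ρ + Du²/(ρ r⁴))`. [folklore] -/
theorem jhOf_le {κ ρ C r δ Du j b : ℝ} (hκ : 0 < κ) (hκ1 : κ ≤ 1) (hρ : 64 ≤ ρ) (hρr : ρ ≤ r) (hC : 0 ≤ C)
    (hr : 1 ≤ r) (hDu : 0 ≤ Du) (hj : 0 ≤ j) (hb : 0 ≤ b) (hΛ1 : lamOf Du j b ≤ 1) :
    jhOf κ ρ C r δ Du Du j b ≤ lcOf κ ^ 13 * (C / ρ ^ 2 + phiOf Du r δ ^ 2 / ρ + Du ^ 2 / (ρ * r ^ 4)) := by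
  have hρ0 : 0 < ρ := by linarith
  have hρ1 : (1 : ℝ) ≤ ρ := by linarith
  have hr0 : 0 < r := by linarith
  obtain ⟨hL, -, -⟩ := lcOf_ge hκ hκ1
  have hL0 : 0 ≤ lcOf κ := le_trans (by norm_num) hL
  have hL1 : 1 ≤ lcOf κ := le_trans (by norm_num) hL
  have hΛ0 : 0 ≤ lamOf Du j b := by unfold lamOf; positivity
  have hΛ2 : lamOf Du j b ^ 2 ≤ 1 := pow_le_one₀ hΛ0 hΛ1
  have hW := wsqOf_le (δ := δ) hκ hκ1 hρ hρr hC hr hDu hj hb hΛ1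
  have hJv := jvOf_le (C := C) (Dv := Du) (Y := ρ) hC hr0 hρ0 le_rfl
  set L := lcOf κ with hLdef
  set Φ := phiOf Du r δ with hΦ
  set U : ℝ := C / ρ ^ 2 + Φ ^ 2 / ρ + Du ^ 2 / (ρ * r ^ 4) with hU
  have hu1 : 0 ≤ C / ρ ^ 2 := by positivity
  have hu2 : 0 ≤ Φ ^ 2 / ρ := by positivity
  have hu3 : 0 ≤ Du ^ 2 / (ρ * r ^ 4) := by positivity
  have hU0 : 0 ≤ U := by positivity
  rw [jhOf_eq]
  have h1 : 2 * jvOf C r Du ρ ≤ 179830784 * U := by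
    have e1 : 4096 * C / ρ ^ 2 = 4096 * (C / ρ ^ 2) := by ring
    have e2 : 89915392 * Du ^ 2 / (r ^ 4 * ρ) = 89915392 * (Du ^ 2 / (ρ * r ^ 4)) := by rw [mul_comm (r ^ 4)]; ring
    rw [e1, e2] at hJv
    rw [hU]; nlinarith only [hJv, hu1, hu2, hu3]
  have h2 : 2 * ρ⁻¹ ^ 8 * wsqOf κ ρ C r δ Du Du j b ≤ 4 * L ^ 12 * U := by
    have hSW : (C + lamOf Du j b ^ 2 * C * ρ ^ 6 + ρ ^ 7 * Φ ^ 2 + ρ ^ 4 * Du ^ 2 / r ^ 4) / ρ ^ 8 ≤ 2 * U := by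
      have e : (C + lamOf Du j b ^ 2 * C * ρ ^ 6 + ρ ^ 7 * Φ ^ 2 + ρ ^ 4 * Du ^ 2 / r ^ 4) / ρ ^ 8 =
          (C / ρ ^ 2) / ρ ^ 6 + lamOf Du j b ^ 2 * (C / ρ ^ 2) + Φ ^ 2 / ρ + (Du ^ 2 / (ρ * r ^ 4)) / ρ ^ 3 := by
        field_simp
      rw [e, hU]
      have ha : (C / ρ ^ 2) / ρ ^ 6 ≤ C / ρ ^ 2 := div_le_self hu1 (one_le_pow₀ hρ1)
      have hb' : lamOf Du j b ^ 2 * (C / ρ ^ 2) ≤ C / ρ ^ 2 := by nlinarith only [hΛ2, hu1]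
      have hc : (Du ^ 2 / (ρ * r ^ 4)) / ρ ^ 3 ≤ Du ^ 2 / (ρ * r ^ 4) := div_le_self hu3 (one_le_pow₀ hρ1)
      linarith
    calc 2 * ρ⁻¹ ^ 8 * wsqOf κ ρ C r δ Du Du j b
        ≤ 2 * ρ⁻¹ ^ 8 * (L ^ 12 * (C + lamOf Du j b ^ 2 * C * ρ ^ 6 + ρ ^ 7 * Φ ^ 2 + ρ ^ 4 * Du ^ 2 / r ^ 4)) :=
          mul_le_mul_of_nonneg_left hW (by positivity)
      _ = 2 * L ^ 12 * ((C + lamOf Du j b ^ 2 * C * ρ ^ 6 + ρ ^ 7 * Φ ^ 2 + ρ ^ 4 * Du ^ 2 / r ^ 4) / ρ ^ 8) := by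
          field_simp
      _ ≤ 2 * L ^ 12 * (2 * U) := mul_le_mul_of_nonneg_left hSW (by positivity)
      _ = 4 * L ^ 12 * U := by ring
  have hL12 : (239000000 : ℝ) ^ 12 ≤ L ^ 12 := pow_le_pow_left₀ (by norm_num) hL 12
  have hcoef : 179830784 + 4 * L ^ 12 ≤ L ^ 13 := by
    have h1 : (179830784 : ℝ) ≤ (1 / 2) * L ^ 12 :=
      (by norm_num : (179830784 : ℝ) ≤ (1 / 2) * 239000000 ^ 12).trans (by nlinarith only [hL12])
    have h2 : (5 : ℝ) * L ^ 12 ≤ L ^ 13 := by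
      rw [show L ^ 13 = L ^ 12 * L by ring]; nlinarith only [hL, pow_nonneg hL0 12]
    nlinarith only [h1, h2, pow_nonneg hL0 12]
  nlinarith only [h1, h2, mul_le_mul_of_nonneg_right hcoef hU0, hU0]

end Summit.AtomisticToContinuum.Crystallization.Theorems.ExcessDecayLiouville

end
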